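import Literature.Computability.Complexity.TokenStreams
import HarnessLib

/-!
# Verified stack programs between unary and binary: parity halving, fixed-width digits, canonical numerals

Trunk `CplxCore`, continuing `StackPrograms.lean` / `StackArith.lean` / `StackUnary.lean` (unary
counters) and `TokenStreams.lean` (`TokConv.incRes`, the binary increment pass): the conversions
between a **unary** counter `1ᵏ` and its **binary** digits that index-computations need when an
index must be written into a query as a fixed-width little-endian field (Liu–Pass's heuristic `ℋ`,
`liuPassHeur_isPPT` of `Cryptography/LiuPassWeakOWF.lean`, queries `⟨…, ⟨natBits (size L) i, z⟩⟩`)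
or returned as a number (Mathlib's canonical `encodeNat`, the output convention of `ℕ`-valued
algorithms). Every program is generic over the register type `ι`, with exact functional effect
(`Function.update`) and step bound (`Com.Runs`):

* `halvePar v a par`: `a` gains `⌊|v|/2⌋` units and `par` one unit iff `|v|` is odd, `v` emptied
  (`runs_halvePar`);
* `digitsLoop dd vi a par o`: for a width counter `dd = 1ᴰ` and a unary value `vi = 1ⁱ`, push the
  `D` little-endian binary digits of `i` onto `o` (`runs_digitsLoop`; the digit list is
  `Literature.CplxCore.natBits D i`, the width-`D` little-endian representation, `bitsToNat_natBits` — the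
  canonical home onto which `Literature.Computability.Cryptography.natBits` (`LiuPassWeakOWF.lean`, also used by
  `SISFunctionSolver.lean`) is to be retired; `OracleSeparationBQPPH.natBits` is a different,
  `testBit`-based function and stays);
* `incr B t t2 fl`: binary increment with carry of a little-endian numeral in `B` — the
  register-generic twin (three scratch registers, drain-and-restore) of the `CReg`-specific
  `TokConv.inc` / `TokConv.runs_inc` of `TokenStreams.lean`
  (`runs_incr`: `B := TokConv.incRes true B`, so `encodeNat k ↦ encodeNat (k + 1)` by
  `TokConv.encodeNat_succ_eq_incRes`), and `toBin u B t t2 fl`: add the unary counter `u` to the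
  numeral (`runs_toBin`: `encodeNat k ↦ encodeNat (k + |u|)`), i.e. unary-to-canonical-binary
  conversion from `B = []`.

## References

* S. Arora, B. Barak, *Computational Complexity: A Modern Approach*, CUP 2009, §1.3 (polynomial
  time is robust under representation changes; counters), Claim 1.6.
* D. E. Knuth, *The Art of Computer Programming*, Vol. 2, 3rd ed., §4.1 (positional number
  systems; binary increment), §4.3.1.
* T. Nipkow, G. Klein, *Concrete Semantics*, Springer 2014, Ch. 7–8 (big-step verification style).
-/

namespace Literature.Computability.Complexity

open _root_.Computability

namespace Com

section Generic

variable {ι : Type} [DecidableEq ι]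

/-! ### Halving with parity -/

/-- `halvePar v a par`: per two units of `v` one unit on `a`; a last unpaired unit is recorded on
`par`. [folklore] -/
def halvePar (v a par : ι) : Com ι :=
  loop v (pop v (push a true) (push a true) (push par true)) (pop v (push a true) (push a true) (push par true))

/-- **Effect of `halvePar`** on `v = 1ⱽ` (cost `≤ 5V + 1`): `a` gains `⌊V/2⌋` units, `par` gains
`V mod 2` units, `v` is emptied. [folklore] -/
theorem runs_halvePar {v a par : ι} (hva : v ≠ a) (hvp : v ≠ par) (hap : a ≠ par) : ∀ (V : ℕ) (R : Regs ι),
    R v = List.replicate V true →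
    Runs (halvePar v a par) R
      (Function.update (Function.update (Function.update R v []) a (List.replicate (V / 2) true ++ R a)) par
        (List.replicate (V % 2) true ++ R par)) (5 * V + 1)
  | 0, R, hR => by
    refine (Runs.loop_nil _ _ hR).of_eq ?_ (by simp)
    ext i : 1
    simp only [Function.update_apply]
    split_ifs <;> simp_all
  | 1, R, hR => by
    have hbody : Runs (pop v (push a true) (push a true) (push par true)) (Function.update R v [])
        (Function.update (Function.update R v []) par (true :: R par)) (1 + 2) := by
      refine Runs.pop_nil _ _ (by simp) ((Runs.push par true _).of_eq ?_ le_rfl)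
      simp [Function.update_of_ne hvp.symm]
    have hrest : Runs (halvePar v a par) (Function.update (Function.update R v []) par (true :: R par))
        (Function.update (Function.update R v []) par (true :: R par)) 1 :=
      Runs.loop_nil _ _ (by simp [Function.update_of_ne hvp])
    refine (Runs.loop_true hR hbody hrest).of_eq ?_ (by norm_num)
    ext i : 1
    simp only [Function.update_apply]
    split_ifs <;> simp_all
  | V + 2, R, hR => by
    have hbody : Runs (pop v (push a true) (push a true) (push par true)) (Function.update R v (List.replicate (V + 1) true))
        (Function.update (Function.update R v (List.replicate V true)) a (true :: R a)) (1 + 2) := by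
      refine Runs.pop_true _ _ (show Function.update R v (List.replicate (V + 1) true) v = true :: List.replicate V true by
        simp [List.replicate_succ]) ((Runs.push a true _).of_eq ?_ le_rfl)
      rw [Function.update_idem]
      simp [Function.update_of_ne hva.symm]
    have ih := runs_halvePar hva hvp hap V (Function.update (Function.update R v (List.replicate V true)) a (true :: R a))
      (by simp [Function.update_of_ne hva])
    refine (Runs.loop_true hR hbody ih).of_eq ?_ (by omega)
    ext i : 1
    simp only [Function.update_apply]
    split_ifs <;> simp_all [List.replicate_succ', show (V + 2) / 2 = V / 2 + 1 by omega, show (V + 2) % 2 = V % 2 by omega]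

end Generic

end Com

/-! ### Fixed-width little-endian digits -/

/-- The width-`D` little-endian binary representation of `i` (exact for `i < 2ᴰ`), the companion
of the value function `bitsToNat` (`BoolEncodings.lean`). Canonical Complexity-side home of the
fixed-width digit functions of the tree: `Literature.Computability.Cryptography.natBits` (`Cryptography/LiuPassWeakOWF.lean`,
same recursion, with `length_natBits`, `bitsVal_natBits`; used there and in
`Cryptography/SISFunctionSolver.lean`, incl. `SIS.bitsToNat_natBits`) is to be retired onto this one
by a librarian pass rewriting those sites; the `testBit`-based variant `OracleSeparationBQPPH.natBits`
(`QuantumComplexity/`) is a different definition and stays. [folklore] -/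
def natBits : ℕ → ℕ → List Bool
  | 0, _ => []
  | D + 1, i => decide (i % 2 = 1) :: natBits D (i / 2)

/-- `natBits D i` has length `D`. [folklore] -/
@[simp] theorem length_natBits : ∀ (D i : ℕ), (natBits D i).length = D
  | 0, _ => rfl
  | D + 1, i => by simp [natBits, length_natBits D]

/-- Reading back the field: `bitsToNat (natBits D i) = i` for `i < 2ᴰ`. [folklore] -/
theorem bitsToNat_natBits : ∀ {D i : ℕ}, i < 2 ^ D → bitsToNat (natBits D i) = i
  | 0, i, h => by simp at h; simp [natBits, h]
  | D + 1, i, h => by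
    have h2 : i / 2 < 2 ^ D := by rw [pow_succ] at h; omega
    rw [natBits, bitsToNat_cons, bitsToNat_natBits h2]
    rcases Nat.mod_two_eq_zero_or_one i with hi | hi
    · simp [hi]; omega
    · simp [hi]; omega

namespace Com

section Generic2

variable {ι : Type} [DecidableEq ι]

/-! ### Digits of a unary value by parity halving -/

/-- One digit: halve `vi` with parity (into the empty scratch `a` and `par`), move the half back to
`vi`, and push the parity digit onto `o`. [folklore] -/
def digitBody (vi a par o : ι) : Com ι :=
  halvePar vi a par ;; pour a vi ;; pop par (push o true) (push o true) (push o false)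

/-- `digitsLoop dd vi a par o`: one digit per unit of the width counter `dd`. [folklore] -/
def digitsLoop (dd vi a par o : ι) : Com ι := loop dd (digitBody vi a par o) (digitBody vi a par o)

/-- **Effect of one digit step** on `vi = 1ⁱ` (cost `≤ 7I + 6`): `vi := 1^{⌊I/2⌋}`, the digit
`[I odd]` pushed on `o`. [folklore] -/
theorem runs_digitBody {vi a par o : ι} (hva : vi ≠ a) (hvp : vi ≠ par) (hvo : vi ≠ o) (hap : a ≠ par)
    (hao : a ≠ o) (hpo : par ≠ o) (I : ℕ) (R : Regs ι) (hv : R vi = List.replicate I true) (ha : R a = [])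
    (hp : R par = []) :
    Runs (digitBody vi a par o) R
      (Function.update (Function.update R vi (List.replicate (I / 2) true)) o (decide (I % 2 = 1) :: R o)) (7 * I + 6) := by
  have h1 := runs_halvePar hva hvp hap I R hv
  rw [ha, hp, List.append_nil, List.append_nil] at h1
  set R₁ := Function.update (Function.update (Function.update R vi []) a (List.replicate (I / 2) true)) par
    (List.replicate (I % 2) true)
  have h2 := runs_pour (a := a) (b := vi) hva.symm R₁
  have hR₁a : R₁ a = List.replicate (I / 2) true := by simp [R₁, Function.update_of_ne hap]
  have hR₁v : R₁ vi = [] := by simp [R₁, Function.update_of_ne hvp, Function.update_of_ne hva]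
  rw [hR₁a, hR₁v, List.append_nil, List.reverse_replicate, List.length_replicate] at h2
  set R₂ := Function.update (Function.update R₁ a []) vi (List.replicate (I / 2) true)
  have hR₂p : R₂ par = List.replicate (I % 2) true := by
    simp [R₂, R₁, Function.update_of_ne hvp.symm, Function.update_of_ne hap.symm]
  have h3 : Runs (pop par (push o true) (push o true) (push o false)) R₂
      (Function.update (Function.update R₂ par []) o (decide (I % 2 = 1) :: R₂ o)) 3 := by
    rcases Nat.mod_two_eq_zero_or_one I with hI | hI
    · rw [hI] at hR₂p
      refine (Runs.pop_nil _ _ hR₂p ((Runs.push o false R₂).of_eq ?_ le_rfl)).mono (by norm_num)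
      rw [hI]
      ext i : 1
      simp only [Function.update_apply]
      split_ifs <;> simp_all
    · rw [hI] at hR₂p
      refine Runs.pop_true _ _ (show R₂ par = true :: [] by rw [hR₂p]; rfl) ((Runs.push o true _).of_eq ?_ le_rfl)
      rw [hI]
      ext i : 1
      simp only [Function.update_apply]
      split_ifs <;> simp_all
  refine (h1.seq (h2.seq h3)).of_eq ?_ (by omega)
  ext i : 1
  simp only [R₂, R₁, Function.update_apply]
  split_ifs <;> simp_all

/-- **Effect of the digit loop** (cost `≤ D (7I + 8) + 1`): the `D` little-endian digits of `I`
are pushed onto `o` (so they appear reversed on top of `o`), `vi := 1^{⌊I/2ᴰ⌋}`. [folklore] -/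
theorem runs_digitsLoop {dd vi a par o : ι} (hdv : dd ≠ vi) (hda : dd ≠ a) (hdp : dd ≠ par) (hdo : dd ≠ o)
    (hva : vi ≠ a) (hvp : vi ≠ par) (hvo : vi ≠ o) (hap : a ≠ par) (hao : a ≠ o) (hpo : par ≠ o) :
    ∀ (D I : ℕ) (R : Regs ι), R dd = List.replicate D true → R vi = List.replicate I true → R a = [] → R par = [] →
    Runs (digitsLoop dd vi a par o) R
      (Function.update (Function.update (Function.update R dd []) vi (List.replicate (I / 2 ^ D) true)) o
        ((natBits D I).reverse ++ R o)) (D * (7 * I + 8) + 1)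
  | 0, I, R, hd, hv, _, _ => by
    refine (Runs.loop_nil _ _ hd).of_eq ?_ (by simp)
    ext i : 1
    simp only [Function.update_apply, natBits, List.reverse_nil, List.nil_append, pow_zero, Nat.div_one]
    split_ifs <;> simp_all
  | D + 1, I, R, hd, hv, ha, hp => by
    have hbody := runs_digitBody hva hvp hvo hap hao hpo I (Function.update R dd (List.replicate D true))
      (by rw [Function.update_of_ne hdv.symm, hv]) (by rw [Function.update_of_ne hda.symm, ha])
      (by rw [Function.update_of_ne hdp.symm, hp])
    set R₁ := Function.update (Function.update (Function.update R dd (List.replicate D true)) vi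
      (List.replicate (I / 2) true)) o (decide (I % 2 = 1) :: Function.update R dd (List.replicate D true) o)
    have ih := runs_digitsLoop hdv hda hdp hdo hva hvp hvo hap hao hpo D (I / 2) R₁
      (by simp [R₁, Function.update_of_ne hdo, Function.update_of_ne hdv])
      (by simp [R₁, Function.update_of_ne hvo])
      (by simp [R₁, Function.update_of_ne hao, Function.update_of_ne hva.symm, Function.update_of_ne hda.symm, ha])
      (by simp [R₁, Function.update_of_ne hpo, Function.update_of_ne hvp.symm, Function.update_of_ne hdp.symm, hp])
    have hle : I / 2 ≤ I := Nat.div_le_self I 2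
    refine (Runs.loop_true (by rw [hd, List.replicate_succ]) hbody (ih.of_eq ?_ le_rfl)).mono ?_
    · ext i : 1
      simp only [R₁, Function.update_apply, natBits, List.reverse_cons, List.append_assoc, List.singleton_append,
        Nat.pow_succ, Nat.div_div_eq_div_mul, Nat.mul_comm 2]
      split_ifs <;> simp_all
    · have : D * (7 * (I / 2) + 8) ≤ D * (7 * I + 8) := Nat.mul_le_mul_left D (by omega)
      rw [show (D + 1) * (7 * I + 8) + 1 = (7 * I + 6) + 2 + (D * (7 * I + 8) + 1) by ring]
      omega

/-! ### Binary increment and unary-to-binary conversion -/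

open TokConv (incRes incRes_cons incRes_nil)

/-- The increment pass without incoming carry is the identity. [folklore] -/
theorem incRes_false : ∀ w : List Bool, incRes false w = w
  | [] => by simp [flag]
  | b :: w => by rw [incRes_cons, Bool.and_false, incRes_false w]; cases b <;> rfl

/-- The carry loop: a low `1` becomes `0` (on `t`); at the first `0` push `1`, raise the flag and
drain the rest of the numeral onto `t2`. [folklore] -/
def incrLoop (B t t2 fl : ι) : Com ι := loop B (push t false) (push t true ;; push fl true ;; pour B t2)

/-- `incr B t t2 fl`: binary increment of the numeral in `B` (least significant digit on top),
with empty scratch `t`, `t2`, `fl`; register-generic twin of the `CReg`-specific `TokConv.inc` of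
`TokenStreams.lean`. [Knuth, TAOCP 2, §4.3.1] [folklore] -/
def incr (B t t2 fl : ι) : Com ι :=
  incrLoop B t t2 fl ;; pop fl skip skip (push B true) ;; pour t2 B ;; pour t B

/-- Functional semantics of the carry loop: final `(t, t2, fl)` from `B = w` and accumulator `T`. [folklore] -/
def incrOut : List Bool → List Bool → List Bool × List Bool × List Bool
  | [], T => (T, [], [])
  | true :: w, T => incrOut w (false :: T)
  | false :: w, T => (true :: T, w.reverse, [true])

/-- Cost of the carry loop. [folklore] -/
def incrCost : List Bool → ℕ
  | [] => 1
  | true :: w => 3 + incrCost w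
  | false :: w => 3 * w.length + 8

/-- The carry-loop cost is linear. [folklore] -/
theorem incrCost_le : ∀ w : List Bool, incrCost w ≤ 3 * w.length + 8
  | [] => by simp [incrCost]
  | true :: w => by have := incrCost_le w; simp [incrCost]; omega
  | false :: w => by simp [incrCost]

/-- **Semantics of the carry loop.** [folklore] -/
theorem runs_incrLoop {B t t2 fl : ι} (hBt : B ≠ t) (hBt2 : B ≠ t2) (hBf : B ≠ fl) (htt2 : t ≠ t2) (htf : t ≠ fl)
    (ht2f : t2 ≠ fl) : ∀ (w T : List Bool) (R : Regs ι), R B = w → R t = T → R t2 = [] → R fl = [] →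
    Runs (incrLoop B t t2 fl) R
      (Function.update (Function.update (Function.update (Function.update R B []) t (incrOut w T).1) t2 (incrOut w T).2.1)
        fl (incrOut w T).2.2) (incrCost w)
  | [], T, R, hB, hT, ht2, hf => by
    refine (Runs.loop_nil _ _ hB).of_eq ?_ (by simp [incrCost])
    ext i : 1
    simp only [Function.update_apply, incrOut]
    split_ifs <;> simp_all
  | true :: w, T, R, hB, hT, ht2, hf => by
    have hbody : Runs (push t false) (Function.update R B w) (Function.update (Function.update R B w) t (false :: T)) 1 :=
      (Runs.push t false _).of_eq (by simp [Function.update_of_ne hBt.symm, hT]) le_rfl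
    have ih := runs_incrLoop hBt hBt2 hBf htt2 htf ht2f w (false :: T) (Function.update (Function.update R B w) t (false :: T))
      (by simp [Function.update_of_ne hBt]) (by simp) (by simp [Function.update_of_ne htt2.symm, Function.update_of_ne hBt2.symm, ht2])
      (by simp [Function.update_of_ne htf.symm, Function.update_of_ne hBf.symm, hf])
    refine (Runs.loop_true hB hbody (ih.of_eq ?_ le_rfl)).of_eq rfl (by simp only [incrCost]; omega)
    ext i : 1
    simp only [Function.update_apply, incrOut]
    split_ifs <;> simp_all
  | false :: w, T, R, hB, hT, ht2, hf => by
    set R₀ := Function.update R B w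
    have h1 : Runs (push t true) R₀ (Function.update R₀ t (true :: T)) 1 :=
      (Runs.push t true _).of_eq (by simp [R₀, Function.update_of_ne hBt.symm, hT]) le_rfl
    have h2 : Runs (push fl true) (Function.update R₀ t (true :: T))
        (Function.update (Function.update R₀ t (true :: T)) fl [true]) 1 :=
      (Runs.push fl true _).of_eq (by simp [R₀, Function.update_of_ne htf.symm, Function.update_of_ne hBf.symm, hf]) le_rfl
    have h3 := runs_pour hBt2 (Function.update (Function.update R₀ t (true :: T)) fl [true])
    have hB₃ : Function.update (Function.update R₀ t (true :: T)) fl [true] B = w := by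
      simp [R₀, Function.update_of_ne hBf, Function.update_of_ne hBt]
    have ht2₃ : Function.update (Function.update R₀ t (true :: T)) fl [true] t2 = [] := by
      simp [R₀, Function.update_of_ne ht2f, Function.update_of_ne htt2.symm, Function.update_of_ne hBt2.symm, ht2]
    rw [hB₃, ht2₃, List.append_nil] at h3
    have hrest : Runs (incrLoop B t t2 fl)
        (Function.update (Function.update (Function.update (Function.update R₀ t (true :: T)) fl [true]) B []) t2 w.reverse)
        (Function.update (Function.update (Function.update (Function.update R₀ t (true :: T)) fl [true]) B []) t2 w.reverse) 1 :=
      Runs.loop_nil _ _ (by simp [Function.update_of_ne hBt2])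
    refine (Runs.loop_false hB ((h1.seq (h2.seq h3))) hrest).of_eq ?_ (by simp only [incrCost]; omega)
    ext i : 1
    simp only [R₀, Function.update_apply, incrOut]
    split_ifs <;> simp_all

/-- Shape of the carry-loop output. [folklore] -/
theorem incrOut_cases : ∀ (w T : List Bool),
    ((incrOut w T).2.2 = [] ∧ w = List.replicate w.length true ∧
        (incrOut w T).1 = List.replicate w.length false ++ T ∧ (incrOut w T).2.1 = []) ∨
    (∃ k w', w = List.replicate k true ++ false :: w' ∧ (incrOut w T).2.2 = [true] ∧
        (incrOut w T).1 = true :: (List.replicate k false ++ T) ∧ (incrOut w T).2.1 = w'.reverse)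
  | [], T => Or.inl ⟨rfl, rfl, rfl, rfl⟩
  | true :: w, T => by
    rcases incrOut_cases w (false :: T) with ⟨h1, h2, h3, h4⟩ | ⟨k, w', hw, h1, h3, h4⟩
    · refine Or.inl ⟨by simpa [incrOut] using h1, ?_, ?_, by simpa [incrOut] using h4⟩
      · simp only [List.length_cons, List.replicate_succ, List.cons.injEq, true_and]; exact h2
      · simp only [incrOut, List.length_cons, h3, List.replicate_succ', List.append_assoc, List.singleton_append]
    · refine Or.inr ⟨k + 1, w', by rw [hw]; rfl, by simpa [incrOut] using h1, ?_, by simpa [incrOut] using h4⟩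
      simp only [incrOut, h3, List.replicate_succ', List.append_assoc, List.singleton_append]
  | false :: w, T => Or.inr ⟨0, w, rfl, rfl, rfl, rfl⟩

/-- The increment of an all-ones word. [folklore] -/
theorem incRes_true_replicate_true (k : ℕ) : incRes true (List.replicate k true) = List.replicate k false ++ [true] := by
  induction k with
  | zero => simp [flag]
  | succ k ih => rw [List.replicate_succ, incRes_cons, Bool.true_and, ih]; rfl

/-- The increment of `1ᵏ 0 w'`. [folklore] -/
theorem incRes_true_replicate_true_append (k : ℕ) (w' : List Bool) :
    incRes true (List.replicate k true ++ false :: w') = List.replicate k false ++ true :: w' := by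
  induction k with
  | zero => rw [List.replicate_zero, List.nil_append, incRes_cons, Bool.false_and, incRes_false]; rfl
  | succ k ih => rw [List.replicate_succ, List.cons_append, incRes_cons, Bool.true_and, ih]; rfl

/-- **Effect of `incr`** (cost `≤ 9|B| + 14`): `B := incRes true B` (the increment pass of
`TokenStreams.lean`), scratch registers empty again. [Knuth, TAOCP 2, §4.3.1] [folklore] -/
theorem runs_incr {B t t2 fl : ι} (hBt : B ≠ t) (hBt2 : B ≠ t2) (hBf : B ≠ fl) (htt2 : t ≠ t2) (htf : t ≠ fl)
    (ht2f : t2 ≠ fl) (R : Regs ι) (ht : R t = []) (ht2 : R t2 = []) (hf : R fl = []) :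
    Runs (incr B t t2 fl) R (Function.update R B (incRes true (R B))) (9 * (R B).length + 14) := by
  generalize hw : R B = w
  have h1 := runs_incrLoop hBt hBt2 hBf htt2 htf ht2f w [] R hw ht ht2 hf
  set R₁ := Function.update (Function.update (Function.update (Function.update R B []) t (incrOut w []).1) t2 (incrOut w []).2.1)
    fl (incrOut w []).2.2
  -- the finishing moves, by cases on the shape of the carry
  rcases incrOut_cases w [] with ⟨hfl, hwrep, hT, hT2⟩ | ⟨k, w', hwk, hfl, hT, hT2⟩
  · -- all ones: `fl` empty, push the new most significant digit
    have h2 : Runs (pop fl skip skip (push B true)) R₁ (Function.update R₁ B [true]) (1 + 2) := by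
      refine Runs.pop_nil _ _ (by simp [R₁, hfl]) ((Runs.push B true R₁).of_eq ?_ le_rfl)
      simp [R₁, Function.update_of_ne hBf, Function.update_of_ne hBt2, Function.update_of_ne hBt]
    have h3 := runs_pour (a := t2) (b := B) hBt2.symm (Function.update R₁ B [true])
    have e3a : Function.update R₁ B [true] t2 = [] := by simp [R₁, Function.update_of_ne ht2f, Function.update_of_ne hBt2.symm, hT2]
    have e3b : Function.update R₁ B [true] B = [true] := by simp
    rw [e3a, e3b] at h3
    simp only [List.length_nil, List.reverse_nil, List.nil_append] at h3
    set R₃ := Function.update (Function.update (Function.update R₁ B [true]) t2 []) B [true]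
    have h4 := runs_pour (a := t) (b := B) hBt.symm R₃
    have e4a : R₃ t = List.replicate w.length false := by
      simp [R₃, R₁, Function.update_of_ne hBt.symm, Function.update_of_ne htt2, Function.update_of_ne htf, hT]
    have e4b : R₃ B = [true] := by simp [R₃]
    rw [e4a, e4b, List.reverse_replicate, List.length_replicate] at h4
    refine ((h1.seq (h2.seq (h3.seq h4))).of_eq ?_ ?_)
    · have hres : incRes true w = List.replicate w.length false ++ [true] := by
        conv_lhs => rw [hwrep]
        exact incRes_true_replicate_true _
      rw [hres]
      clear hwrep hres
      ext i : 1
      simp only [R₃, R₁, Function.update_apply]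
      split_ifs <;> simp_all
    · have := incrCost_le w; omega
  · -- a zero was found: `fl` raised, restore the drained rest, then the processed low digits
    have h2 : Runs (pop fl skip skip (push B true)) R₁ (Function.update R₁ fl []) (0 + 2) :=
      Runs.pop_true _ _ (show R₁ fl = true :: [] by simp [R₁, hfl]) (Runs.skip _)
    have h3 := runs_pour (a := t2) (b := B) hBt2.symm (Function.update R₁ fl [])
    have e3a : Function.update R₁ fl [] t2 = w'.reverse := by simp [R₁, Function.update_of_ne ht2f, hT2]
    have e3b : Function.update R₁ fl [] B = [] := by
      simp [R₁, Function.update_of_ne hBf, Function.update_of_ne hBt2, Function.update_of_ne hBt]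
    rw [e3a, e3b, List.reverse_reverse, List.append_nil, List.length_reverse] at h3
    set R₃ := Function.update (Function.update (Function.update R₁ fl []) t2 []) B w'
    have h4 := runs_pour (a := t) (b := B) hBt.symm R₃
    have e4a : R₃ t = true :: (List.replicate k false ++ []) := by
      simp [R₃, R₁, Function.update_of_ne hBt.symm, Function.update_of_ne htt2, Function.update_of_ne htf, hT]
    have e4b : R₃ B = w' := by simp [R₃]
    rw [e4a, e4b] at h4
    simp only [List.append_nil, List.reverse_cons, List.reverse_replicate, List.length_cons, List.length_replicate,
      List.append_assoc, List.singleton_append] at h4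
    refine ((h1.seq (h2.seq (h3.seq h4))).of_eq ?_ ?_)
    · have hres : incRes true w = List.replicate k false ++ true :: w' := by
        rw [hwk]; exact incRes_true_replicate_true_append k w'
      rw [hres]
      ext i : 1
      simp only [R₃, R₁, Function.update_apply]
      split_ifs <;> simp_all
    · have := incrCost_le w
      have hl : w.length = k + 1 + w'.length := by rw [hwk]; simp; omega
      omega

/-- `toBin u B t t2 fl`: one increment per unit of the counter `u`. [folklore] -/
def toBin (u B t t2 fl : ι) : Com ι := loop u (incr B t t2 fl) (incr B t t2 fl)

/-- **Effect of `toBin`** on `B = encodeNat k`, `u = 1ᵁ` (cost `≤ U (9 (k + U) + 16) + 1`):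
`B := encodeNat (k + U)`; from `k = 0` this is the unary-to-binary conversion. [folklore] -/
theorem runs_toBin {u B t t2 fl : ι} (huB : u ≠ B) (hut : u ≠ t) (hut2 : u ≠ t2) (huf : u ≠ fl) (hBt : B ≠ t)
    (hBt2 : B ≠ t2) (hBf : B ≠ fl) (htt2 : t ≠ t2) (htf : t ≠ fl) (ht2f : t2 ≠ fl) :
    ∀ (U k : ℕ) (R : Regs ι), R u = List.replicate U true → R B = encodeNat k → R t = [] → R t2 = [] → R fl = [] →
    Runs (toBin u B t t2 fl) R (Function.update (Function.update R u []) B (encodeNat (k + U)))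
      (U * (9 * (k + U) + 16) + 1)
  | 0, k, R, hu, hB, _, _, _ => by
    refine (Runs.loop_nil _ _ hu).of_eq ?_ (by simp)
    ext i : 1
    simp only [Function.update_apply, Nat.add_zero]
    split_ifs <;> simp_all
  | U + 1, k, R, hu, hB, ht, ht2, hf => by
    have hbody := runs_incr hBt hBt2 hBf htt2 htf ht2f (Function.update R u (List.replicate U true))
      (by rw [Function.update_of_ne hut.symm, ht]) (by rw [Function.update_of_ne hut2.symm, ht2])
      (by rw [Function.update_of_ne huf.symm, hf])
    rw [Function.update_of_ne huB.symm, hB, ← TokConv.encodeNat_succ_eq_incRes] at hbody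
    set R₁ := Function.update (Function.update R u (List.replicate U true)) B (encodeNat (k + 1))
    have ih := runs_toBin huB hut hut2 huf hBt hBt2 hBf htt2 htf ht2f U (k + 1) R₁
      (by simp [R₁, Function.update_of_ne huB]) (by simp [R₁])
      (by simp [R₁, Function.update_of_ne hBt.symm, Function.update_of_ne hut.symm, ht])
      (by simp [R₁, Function.update_of_ne hBt2.symm, Function.update_of_ne hut2.symm, ht2])
      (by simp [R₁, Function.update_of_ne hBf.symm, Function.update_of_ne huf.symm, hf])
    have hlen := TokConv.length_encodeNat_le k
    refine (Runs.loop_true (by rw [hu, List.replicate_succ]) hbody (ih.of_eq ?_ le_rfl)).mono ?_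
    · ext i : 1
      simp only [R₁, Function.update_apply, show k + 1 + U = k + (U + 1) by ring]
      split_ifs <;> simp_all
    · have e1 : 9 * (encodeNat k).length + 14 ≤ 9 * k + 14 := by omega
      have e2 : U * (9 * (k + 1 + U) + 16) = U * (9 * (k + (U + 1)) + 16) := by ring_nf
      nlinarith [e1, e2]

end Generic2

end Com

end Literature.Computability.Complexity
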